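import Mathlib
import HarnessLib
import Literature.Analysis.FluidPDE.SlabTypeICompactnessSharp
import Literature.Analysis.FluidPDE.LocalTypeICongr
import Literature.Analysis.FluidPDE.LocalTypeIScaling
import Summits.NavierStokesRegularity.NavierStokesRegularity.Theorems.RellichScarApexLocalisationTracelessHalfspaceLiouville
import Summits.NavierStokesRegularity.NavierStokesRegularity.Theorems.RellichScarApexLocalisationHalfspaceZoomLimit

/-!
# The half-space scar floor of rate-Type-I singular slab profiles (line calm-cone-carleman, crux
# ApexLocalisation stmt-NavierStokesRegularity-11719, stub `stub_halfspaceScarFloor` = S_C)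

**Theorem (S_C).** For every rate constant `C`, aperture `η > 0` and bound `I < ⊤` there is
`ε₀ = ε₀(C, η, I) > 0` such that every suitable weak Navier–Stokes solution `(u, p)` on the backward slab
`]-∞,0[ × ℝ³` with a weak gradient `G`, Albritton–Barker quantity `𝐈(u, p, G) ≤ I`, the Type-I RATE
`‖u(t,x)‖ ≤ C/√(−t)` and a backward-singular space–time origin is `ε₀`-LOUD in every open half-space
through the origin at every scale: for every unit vector `e` and every `δ > 0` some `x` with `⟪x,e⟫ > 0`,
`‖x‖ < δ`, and some `t ∈ ]−η‖x‖², 0[` have `‖x‖‖u(t,x)‖ > ε₀`.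

This is the quantitative contrapositive, over the compact class `𝐈 ≤ I`, of the traceless half-space
Liouville theorem S_A = `stub_tracelessHalfspaceLiouville` (K1′ = `stub_tracelessConeLiouville` at `κ = 0`, its
backward-uniqueness input being ESS 2003, Thm. 5.1 = `Carleman.backwardUniqueness_uncurried_c12`).  Proof: otherwise there are profiles
`u_n`, unit directions `e_n` and scales `δ_n` with `‖x‖‖u_n(t,x)‖ ≤ 1/(n+1)` on the window
`{⟪x,e_n⟫ > 0, ‖x‖ < δ_n, −η‖x‖² < t < 0}`; zooming by `δ_n` (the class is scaling covariant:
`RellichScarNoMildScarZoom`, `typeIBound_lowerHalf_nsZoom`, `halfspaceZoom_rate`, `halfspaceZoom_faint`)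
makes `δ_n = 1`; a subsequence of directions converges on the unit sphere, and the ENGINE
`slab_typeI_compactness_sharp` (Albritton–Barker 2019, Lemma 2.2, Prop. 2.3, §3) produces an
`L³_loc`-limit which is a suitable weak slab solution with `𝐈 ≤ I`, a singular origin (blow-up clause)
and — `halfspaceZoom_ae_limit_bound` — the rate a.e. and `w = 0` a.e. on the limit window
`{⟪x,e_∞⟫ > 0, ‖x‖ < 1, −η‖x‖² < t < 0}`.  Its pointwise representative (zero on the window, pattern
`exists_rate_profile_repr`) is scar-faint on the half-space `{⟪x,e_∞⟫ > 0}` and singular at the origin,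
contradicting S_A.

References: D. Albritton, T. Barker, J. Math. Fluid Mech. 21 (2019) = arXiv:1811.00502, Lemma 2.2,
Prop. 2.3, §3; L. Escauriaza, G. Seregin, V. Šverák, Russ. Math. Surveys 58 (2003), Thms. 1.4, 5.1.
-/

noncomputable section

set_option linter.dupNamespace false

namespace Summit.NavierStokesRegularity.NavierStokesRegularity.Theorems.RellichScarApexLocalisation

open MeasureTheory Set Function Metric Filter Topology TopologicalSpace
open scoped ENNReal NNReal InnerProductSpace RealInnerProductSpace
open Literature.Analysis Literature.Analysis.FluidPDE
open Summit.NavierStokesRegularity.NavierStokesRegularity.Theorems.RellichScarNoMildScar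

local notation "E³" => EuclideanSpace ℝ (Fin 3)

/-- The open backward slab `(-∞, 0) × ℝ³` (time first). -/
local notation "𝕊" => Literature.Analysis.FluidPDE.slab (EuclideanSpace ℝ (Fin 3)) (Set.Iio (0 : ℝ)) isOpen_Iio

/-! ### The blow-up limit of an asymptotically faint sequence in the class `𝐈 ≤ I` -/

/-- **Limit extraction.** Let `(v_k, q_k, G_k)` be suitable weak slab solutions with weak gradients,
`𝐈 ≤ I < ⊤`, the rate `C`, backward-singular origins, and faint at level `1/(k+1)` on the unit window of
the half-space `{⟪y, e_k⟫ > 0}` (`‖y‖‖v_k(s,y)‖ ≤ 1/(k+1)` for `‖y‖ < 1`, `−η‖y‖² < s < 0`), `e_k` unit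
vectors.  Then along a subsequence `e_k → e_∞` (compactness of the unit sphere) and the ENGINE
`slab_typeI_compactness_sharp` yields a suitable weak slab solution `(w, π, H)` with `𝐈 ≤ I`, a singular
origin (every `v_k` is singular there, so the blow-up clause applies), the rate almost everywhere, and
`w = 0` almost everywhere on the limit window `{⟪y,e_∞⟫ > 0, ‖y‖ < 1, −η‖y‖² < s < 0}` (for a point of
that window `⟪y, e_k⟫ > 0` and `1/(k+1) ≤ 1/(m+1)` for all large `k`, so `‖y‖‖w‖ ≤ 1/(m+1)` a.e. for
every `m` by `halfspaceZoom_ae_limit_bound`). [cite: AlbrittonBarker2019, Lemma 2.2, Prop. 2.3 and §3] -/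
theorem scarFloor_limit {C η : ℝ} {I : ℝ≥0∞} (hI : I < ⊤) {e : ℕ → E³} (he : ∀ k, ‖e k‖ = 1)
    {v : ℕ → ℝ → E³ → E³} {q : ℕ → ℝ → E³ → ℝ} {Gk : ℕ → ℝ → E³ → E³ →L[ℝ] E³}
    (hsw : ∀ k, IsSuitableWeakSolutionOn 𝕊 1 0 (v k) (q k))
    (hwg : ∀ k, HasWeakSpatialGradientOn 𝕊 (v k) (Gk k))
    (hbd : ∀ k, typeIBound (Iio (0 : ℝ) ×ˢ univ) (v k) (q k) (Gk k) ≤ I)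
    (hsing : ∀ k, IsBackwardSingularPoint (v k) 0)
    (hrate : ∀ k (z : ℝ × E³), z.1 < 0 → ‖v k z.1 z.2‖ ≤ C / Real.sqrt (-z.1))
    (hfaint : ∀ k (y : E³), 0 < ⟪y, e k⟫ → ‖y‖ < 1 → ∀ s : ℝ, -η * ‖y‖ ^ 2 < s → s < 0 →
      ‖y‖ * ‖v k s y‖ ≤ 1 / ((k : ℝ) + 1)) :
    ∃ (e' : E³) (w : ℝ → E³ → E³) (π : ℝ → E³ → ℝ) (H : ℝ → E³ → E³ →L[ℝ] E³),
      ‖e'‖ = 1 ∧ IsSuitableWeakSolutionOn 𝕊 1 0 w π ∧ HasWeakSpatialGradientOn 𝕊 w H ∧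
      typeIBound (Iio (0 : ℝ) ×ˢ univ) w π H ≤ I ∧ IsBackwardSingularPoint w 0 ∧
      (∀ᵐ z ∂(volume.restrict (Iio (0 : ℝ) ×ˢ (univ : Set E³))), ‖w z.1 z.2‖ ≤ C / Real.sqrt (-z.1)) ∧
      (∀ᵐ z ∂(volume.restrict (Iio (0 : ℝ) ×ˢ (univ : Set E³))),
        0 < ⟪z.2, e'⟫ → ‖z.2‖ < 1 → -η * ‖z.2‖ ^ 2 < z.1 → w z.1 z.2 = 0) := by
  -- ## a convergent subsequence of directions on the unit sphere
  obtain ⟨e', he', φ, hφ, hφe⟩ := (isCompact_sphere (0 : E³) 1).tendsto_subseq (x := e)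
    fun k => mem_sphere_zero_iff_norm.2 (he k)
  have he'1 : ‖e'‖ = 1 := mem_sphere_zero_iff_norm.1 he'
  -- ## the ENGINE along the subsequence
  obtain ⟨w, π, H, σ, hσ, hsww, hH, hIw, hconv, hpers⟩ :=
    slab_typeI_compactness_sharp I (fun k => v (φ k)) (fun k => q (φ k)) (fun k => Gk (φ k)) hI
      (fun k => hsw (φ k)) (fun k => hwg (φ k)) (fun k => hbd (φ k))
  have hconv' : ∀ R : ℝ, 0 < R → Tendsto (fun j => eLpNorm (uncurry (v (φ (σ j))) - uncurry w) 3
      (volume.restrict (parabolicCylinder R (0 : ℝ × E³)))) atTop (𝓝 0) := hconv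
  -- ## the origin is a backward singular point of the limit
  have hsingw : IsBackwardSingularPoint w 0 := by
    refine hpers fun R hR => ?_
    have hc : (fun j => eLpNorm (uncurry (v (φ (σ j)))) ⊤
        (volume.restrict (parabolicCylinder R (0 : ℝ × E³)))) = fun _ => ⊤ := by
      funext j
      exact hsing (φ (σ j)) R hR
    show limsup (fun j => eLpNorm (uncurry (v (φ (σ j)))) ⊤
        (volume.restrict (parabolicCylinder R (0 : ℝ × E³)))) atTop = ⊤
    rw [hc]
    exact limsup_const ⊤
  -- ## measurability
  have hvm : ∀ j, AEStronglyMeasurable (uncurry (v (φ (σ j))))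
      (volume.restrict (Iio (0 : ℝ) ×ˢ (univ : Set E³))) := fun j =>
    (hwg (φ (σ j))).locallyIntegrableOn.aestronglyMeasurable
  have hum : AEStronglyMeasurable (uncurry w) (volume.restrict (Iio (0 : ℝ) ×ˢ (univ : Set E³))) :=
    hH.locallyIntegrableOn.aestronglyMeasurable
  -- ## the rate bound passes to the a.e. limit
  have hratew : ∀ᵐ z ∂(volume.restrict (Iio (0 : ℝ) ×ˢ (univ : Set E³))),
      ‖w z.1 z.2‖ ≤ C / Real.sqrt (-z.1) := by
    have h := halfspaceZoom_ae_limit_bound (v := fun j => v (φ (σ j))) hvm hum hconv' (fun _ => True)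
      (fun _ y => ‖y‖) (fun z => C / Real.sqrt (-z.1)) (fun _ => continuous_norm)
      (fun z hz _ => Eventually.of_forall fun j => hrate (φ (σ j)) z hz)
    filter_upwards [h] with z hz
    exact hz trivial
  -- ## the limit vanishes a.e. on the limit window
  have hm : ∀ m : ℕ, ∀ᵐ z ∂(volume.restrict (Iio (0 : ℝ) ×ˢ (univ : Set E³))),
      (0 < ⟪z.2, e'⟫ ∧ ‖z.2‖ < 1 ∧ -η * ‖z.2‖ ^ 2 < z.1) →
        ‖z.2‖ * ‖w z.1 z.2‖ ≤ 1 / ((m : ℝ) + 1) := by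
    intro m
    refine halfspaceZoom_ae_limit_bound (v := fun j => v (φ (σ j))) hvm hum hconv'
      (fun z => 0 < ⟪z.2, e'⟫ ∧ ‖z.2‖ < 1 ∧ -η * ‖z.2‖ ^ 2 < z.1) (fun z y => ‖z.2‖ * ‖y‖)
      (fun _ => 1 / ((m : ℝ) + 1)) (fun _ => continuous_const.mul continuous_norm) ?_
    rintro z hz ⟨hze, hz1, hzη⟩
    -- eventually the moving half-space contains the point
    have hdir : ∀ᶠ j in atTop, 0 < ⟪z.2, e (φ (σ j))⟫ := by
      have ht : Tendsto (fun j => ⟪z.2, e (φ (σ j))⟫) atTop (𝓝 ⟪z.2, e'⟫) :=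
        ((continuous_const.inner continuous_id).tendsto e').comp (hφe.comp hσ.tendsto_atTop)
      exact ht.eventually (lt_mem_nhds hze)
    -- eventually the level is below `1/(m+1)`
    have hlev : ∀ᶠ j in atTop, 1 / ((φ (σ j) : ℝ) + 1) ≤ 1 / ((m : ℝ) + 1) := by
      refine eventually_atTop.2 ⟨m, fun j hj => ?_⟩
      have h1 : m ≤ φ (σ j) := hj.trans (hφ.comp hσ).le_apply
      have h2 : (m : ℝ) ≤ (φ (σ j) : ℝ) := by exact_mod_cast h1
      exact one_div_le_one_div_of_le (by positivity) (by linarith)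
    filter_upwards [hdir, hlev] with j hj hj'
    exact (hfaint (φ (σ j)) z.2 hj hz1 z.1 hzη hz).trans hj'
  have hzero : ∀ᵐ z ∂(volume.restrict (Iio (0 : ℝ) ×ˢ (univ : Set E³))),
      0 < ⟪z.2, e'⟫ → ‖z.2‖ < 1 → -η * ‖z.2‖ ^ 2 < z.1 → w z.1 z.2 = 0 := by
    rw [← ae_all_iff] at hm
    filter_upwards [hm] with z hz hze hz1 hzη
    have hn0 : 0 < ‖z.2‖ := by
      refine norm_pos_iff.2 fun h0 => ?_
      rw [h0, inner_zero_left] at hze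
      exact lt_irrefl _ hze
    have hle : ‖z.2‖ * ‖w z.1 z.2‖ ≤ 0 :=
      ge_of_tendsto' tendsto_one_div_add_atTop_nhds_zero_nat fun m => hz m ⟨hze, hz1, hzη⟩
    have h2 : ‖w z.1 z.2‖ ≤ 0 := le_of_mul_le_mul_left (by rw [mul_zero]; exact hle) hn0
    exact norm_le_zero_iff.1 h2
  exact ⟨e', w, π, H, he'1, hsww, hH, hIw, hsingw, hratew, hzero⟩

/-! ### The pointwise representative, zero on the window -/

/-- **Representative.** If a suitable weak slab solution `(w, π, H)` with a singular origin obeys the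
rate `C ≥ 0` almost everywhere and vanishes almost everywhere on the window
`W = {⟪x,e⟫ > 0, ‖x‖ < 1, −η‖x‖² < t}` of the slab, then the modification `u' = 0` on `W`, `u' = w` where
the rate holds, `u' = 0` elsewhere, equals `w` a.e. on the slab; hence (`SuitableWeakCongr`,
`LocalTypeICongr`) it is a suitable weak solution with the same pressure, gradient and `𝐈`, singular at
the origin, with the rate POINTWISE and identically zero on `W`. [cite: AlbrittonBarker2019, §1] -/
theorem scarFloor_repr {C η : ℝ} (hC : 0 ≤ C) (e : E³) {w : ℝ → E³ → E³} {π : ℝ → E³ → ℝ}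
    {H : ℝ → E³ → E³ →L[ℝ] E³}
    (hsw : IsSuitableWeakSolutionOn 𝕊 1 0 w π) (hwg : HasWeakSpatialGradientOn 𝕊 w H)
    (hsing : IsBackwardSingularPoint w 0)
    (hrate : ∀ᵐ z ∂(volume.restrict (Iio (0 : ℝ) ×ˢ (univ : Set E³))),
      ‖w z.1 z.2‖ ≤ C / Real.sqrt (-z.1))
    (hzero : ∀ᵐ z ∂(volume.restrict (Iio (0 : ℝ) ×ˢ (univ : Set E³))),
      0 < ⟪z.2, e⟫ → ‖z.2‖ < 1 → -η * ‖z.2‖ ^ 2 < z.1 → w z.1 z.2 = 0) :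
    ∃ u' : ℝ → E³ → E³,
      IsSuitableWeakSolutionOn 𝕊 1 0 u' π ∧ HasWeakSpatialGradientOn 𝕊 u' H ∧
      typeIBound (Iio (0 : ℝ) ×ˢ univ) u' π H = typeIBound (Iio (0 : ℝ) ×ˢ univ) w π H ∧
      HasTypeITimeDecay C u' ∧ IsBackwardSingularPoint u' 0 ∧
      (∀ x : E³, 0 < ⟪x, e⟫ → ‖x‖ < 1 → ∀ t : ℝ, -η * ‖x‖ ^ 2 < t → u' t x = 0) := by
  classical
  set u' : ℝ → E³ → E³ := fun t x =>
    if 0 < ⟪x, e⟫ ∧ ‖x‖ < 1 ∧ -η * ‖x‖ ^ 2 < t then 0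
    else if ‖w t x‖ ≤ C / Real.sqrt (-t) then w t x else 0 with hu'
  have hae : ∀ᵐ z ∂(volume.restrict (Iio (0 : ℝ) ×ˢ (univ : Set E³))),
      uncurry w z = uncurry u' z := by
    filter_upwards [hrate, hzero] with z hzr hz0
    simp only [uncurry, hu']
    by_cases hW : 0 < ⟪z.2, e⟫ ∧ ‖z.2‖ < 1 ∧ -η * ‖z.2‖ ^ 2 < z.1
    · rw [if_pos hW]
      exact hz0 hW.1 hW.2.1 hW.2.2
    · rw [if_neg hW, if_pos hzr]
  have hdec : HasTypeITimeDecay C u' := by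
    intro t _ x
    simp only [hu']
    split_ifs with h1 h2
    · rw [norm_zero]
      exact div_nonneg hC (Real.sqrt_nonneg _)
    · exact h2
    · rw [norm_zero]
      exact div_nonneg hC (Real.sqrt_nonneg _)
  have hae' : ∀ᵐ z ∂(volume.restrict ((𝕊 : Opens (ℝ × E³)) : Set (ℝ × E³))),
      uncurry w z = uncurry u' z := by
    rw [coe_slab]
    exact hae
  refine ⟨u', hsw.congr_ae hae' (ae_of_all _ fun _ => rfl), hwg.congr_ae hae',
    (typeIBound_congr_ae hae).symm, hdec,
    hsing.congr_ae (fun r _ => parabolicCylinder_origin_subset_slab r) hae, fun x hx hx1 t ht => ?_⟩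
  simp only [hu']
  rw [if_pos ⟨hx, hx1, ht⟩]

/-! ### S_C: the scar floor -/

/-- **S_C (stub_halfspaceScarFloor).** For `0 < η` and `I < ⊤` there is `ε₀ > 0` such that every suitable
weak slab solution with a weak gradient, `𝐈 ≤ I < ⊤` and the Type-I rate `C` is `ε₀`-LOUD in every open half-space
through the origin at every scale: for every unit `e` and `δ > 0` some `x` with `⟪x,e⟫ > 0`, `‖x‖ < δ` and some
`t ∈ ]−η‖x‖², 0[` have `‖x‖‖u(t,x)‖ > ε₀`.  Proof: otherwise profiles `u_n`, directions `e_n`, scales `δ_n` with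
`‖x‖‖u_n‖ ≤ 1/(n+1)` on the window; rescale by `δ_n` (the class is scaling-covariant), pass to a subsequence
`e_n → e` and to the limit of `slab_typeI_compactness_sharp` (singular origin by its blow-up clause, rate a.e.), which
vanishes a.e. on `{⟪x,e⟫ > 0, ‖x‖ < 1, −η‖x‖² < t < 0}`; its pointwise representative (`exists_rate_profile_repr`
pattern, set to `0` there) is scar-faint on the half-space, contradicting S_A. [cite: AlbrittonBarker2019, Prop. 2.3 and §3] -/
theorem stub_halfspaceScarFloor :
    ∀ (C η : ℝ) (I : ℝ≥0∞), 0 < η → I < ⊤ → ∃ ε₀ : ℝ, 0 < ε₀ ∧ ∀ (e : E³), ‖e‖ = 1 →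
      ∀ (u : ℝ → E³ → E³) (p : ℝ → E³ → ℝ) (G : ℝ → E³ → E³ →L[ℝ] E³),
      IsSuitableWeakSolutionOn 𝕊 1 0 u p → HasWeakSpatialGradientOn 𝕊 u G →
      typeIBound (Iio (0 : ℝ) ×ˢ univ) u p G ≤ I → HasTypeITimeDecay C u → IsBackwardSingularPoint u 0 →
      ∀ δ : ℝ, 0 < δ → ∃ x : E³, 0 < ⟪x, e⟫ ∧ ‖x‖ < δ ∧ ∃ t : ℝ, -η * ‖x‖ ^ 2 < t ∧ t < 0 ∧
        ε₀ < ‖x‖ * ‖u t x‖ := by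
  intro C η I hη hI
  by_contra hcon
  push Not at hcon
  -- ## an asymptotically faint sequence in the class
  choose e he u p G hsw hwg hbd hrate hsing δ hδ hfaint using
    fun n : ℕ => hcon (1 / ((n : ℝ) + 1)) (by positivity)
  have hC : 0 ≤ C := by
    have h := hrate 0 (-1) (by norm_num) 0
    rw [neg_neg, Real.sqrt_one, div_one] at h
    exact (norm_nonneg _).trans h
  -- ## zoom by `δ_n`: the window becomes the unit window
  set v : ℕ → ℝ → E³ → E³ := fun n => δ n • stPull (δ n ^ 2) (δ n) 0 (0 : E³) (u n) with hv
  set qn : ℕ → ℝ → E³ → ℝ := fun n => δ n ^ 2 • stPull (δ n ^ 2) (δ n) 0 (0 : E³) (p n) with hqn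
  set Gn : ℕ → ℝ → E³ → E³ →L[ℝ] E³ :=
    fun n => δ n ^ 2 • stPull (δ n ^ 2) (δ n) 0 (0 : E³) (G n) with hGn
  have hswn : ∀ n, IsSuitableWeakSolutionOn 𝕊 1 0 (v n) (qn n) := fun n =>
    zoom_isSuitableWeakSolutionOn_slab (hsw n) (hδ n)
  have hwgn : ∀ n, HasWeakSpatialGradientOn 𝕊 (v n) (Gn n) := fun n =>
    zoom_hasWeakSpatialGradientOn_slab (hwg n) (hδ n)
  have hbdn : ∀ n, typeIBound (Iio (0 : ℝ) ×ˢ univ) (v n) (qn n) (Gn n) ≤ I := fun n =>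
    (typeIBound_lowerHalf_nsZoom (hδ n) (u n) (p n) (G n)).trans_le (hbd n)
  have hsingn : ∀ n, IsBackwardSingularPoint (v n) 0 := fun n =>
    zoom_isBackwardSingularPoint (hsing n) (hδ n)
  have hraten : ∀ n (z : ℝ × E³), z.1 < 0 → ‖v n z.1 z.2‖ ≤ C / Real.sqrt (-z.1) := fun n z hz =>
    halfspaceZoom_rate (hrate n) (hδ n) z.1 hz z.2
  have hfaintn : ∀ n (y : E³), 0 < ⟪y, e n⟫ → ‖y‖ < 1 → ∀ s : ℝ, -η * ‖y‖ ^ 2 < s → s < 0 →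
      ‖y‖ * ‖v n s y‖ ≤ 1 / ((n : ℝ) + 1) := fun n y hy hy1 s hs hs0 =>
    halfspaceZoom_faint (hfaint n) (hδ n) hy (mul_lt_of_lt_one_right (hδ n) hy1) hs hs0
  -- ## the blow-up limit and its representative
  obtain ⟨e', w, π, H, he', hsww, hH, hIw, hsingw, hratew, hzerow⟩ :=
    scarFloor_limit hI he hswn hwgn hbdn hsingn hraten hfaintn
  obtain ⟨u', hsw', hwg', hI', hdec', hsing', hz'⟩ := scarFloor_repr hC e' hsww hH hsingw hratew hzerow
  have hIlt : typeIBound (Iio (0 : ℝ) ×ˢ univ) u' π H < ⊤ := by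
    rw [hI']
    exact lt_of_le_of_lt hIw hI
  -- ## contradiction with S_A: the representative is scar-faint on the half-space `{⟪x,e'⟫ > 0}`
  refine stub_tracelessHalfspaceLiouville C e' he' u' π H hsw' hwg' hIlt hdec' ?_ hsing'
  intro ε hε
  refine ⟨1, one_pos, η, hη, fun x hx hx1 t ht _ => ?_⟩
  rw [hz' x hx hx1 t ht, norm_zero, mul_zero]
  exact hε.le

end Summit.NavierStokesRegularity.NavierStokesRegularity.Theorems.RellichScarApexLocalisation

end
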